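import Summits.QuantumAdvantage.QuantumAdvantage.Theorems.RankDialH1
import HarnessLib

/-!
# RankDial (H2) — §20 the MIXED FIBRE THEOREM (`three_mul_card_parClass_le`, `mixed_err_absorb`, `twelve_mul_win_fibre_le_mixed`) and the mixed window theorem

TARGET BY NAME (cell decomp-qadv, RESIDUAL MODE): item stmt-QuantumAdvantage-23109
`Summit.QuantumAdvantage.QuantumAdvantage.Theses.OddPrimeWalk.ManyReadersSqrtOdd`, through rung R5 = `AdviceFreeQNC0.WalkHardFLinSel p`.
This file SUPPORTS the item (`--supports`); it does not close it.  Declaration bodies are byte-identical to the cell node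
«MixedDial» (decomp-qadv lens-1, generation 26, part H; node file RankDialH.lean, whose §1–§17 are node «DegreeDial» =
parts G1–G2), cut into ≤ 400-line parts
H1 (§18 Viola–Wigderson with per-coordinate phases, §19 characters / phases / wide-test expansion) → H2 (§20 mixed fibre and window theorems) → H3 (§21 pieces `WindowMixedLinSel` PROVED `p ≠ 3`, residual `WindowCrowdLinSel`, `mixed_dial`);
see the node file for the mechanism summary.
-/

set_option linter.dupNamespace false
set_option autoImplicit false

noncomputable section
open Classical

namespace Summit.QuantumAdvantage.QuantumAdvantage.Theorems.RankDial

open Finset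
open Summit.QuantumAdvantage.AdviceFreeQNC0
open Literature.Computability.MetaComplexity Literature.Computability.MetaComplexity.Smolensky

/-! ### §20 The MIXED FIBRE THEOREM: narrow readers by degree, wide readers by characters -/

section MixedFibre
variable {p : ℕ} [Fact p.Prime] {L ℓ R : ℕ} (c : ℕ) (y : Fin (L + ℓ + R + 1) → (Fin (L + ℓ + R) → Bool) → Bool)
  (lam : Fin (L + ℓ + R + 1) → Fin (L + ℓ + R) → ZMod p) (rr : Fin (L + ℓ + R + 1) → ZMod p)

/-- The WIDE cuts of a linear representation at width `s`: window support `> s`. -/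
def wideCuts (s : ℕ) : Finset (Fin (L + ℓ + R + 1)) := univ.filter fun g => s < (wsupp lam g).card

/-- `(−1)^{Σ} = Π (−1)^{·}`. -/
theorem signChar_finset_sum {κ : Type*} (S : Finset κ) (f : κ → ZMod 2) :
    GowersCube.signChar (∑ x ∈ S, f x) = ∏ x ∈ S, GowersCube.signChar (f x) := by
  induction S using Finset.induction_on with
  | empty => simp
  | @insert x S hx ih => rw [Finset.sum_insert hx, Finset.prod_insert hx, GowersCube.signChar_add, ih]

/-- Under a linear representation the sign of a fire function IS the sign of the affine window test. -/
theorem signChar_fireFn (hyl : ∀ g u, y g u = decide ((∑ i, if u i then lam g i else 0) = rr g))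
    (a : Fin L → Bool) (b : Fin R → Bool) (g : Fin (L + ℓ + R + 1)) (v : Fin ℓ → Bool) :
    GowersCube.signChar (fireFn y a b g v) = hypSgn (lamW lam g) (rhoW lam rr a b g) v := by
  unfold fireFn hypSgn linPart
  rw [linSel_glue3 y lam rr hyl g a v b]
  by_cases h : (∑ j, if v j then lamW lam g j else 0) = rhoW lam rr a b g
  · simp [h]
  · simp [h]

/-- **THE CLASS-SUM BOUND**: for `p ≠ 3`, on every fibre and for every class `r`,
`‖Σ_v (−1)^{classPar_r(v)} ω^{|v|}‖ ≤ 3^{#wide} · 2^ℓ · exp(−η_p ℓ/4^{s+1})`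
(narrow live cuts ⟶ a degree-`≤ s` polynomial `Qn`, wide live cuts ⟶ `≤ 3^{#wide}` characters, §18–§19). -/
theorem norm_classSum_le (hp3 : p ≠ 3)
    (hyl : ∀ g u, y g u = decide ((∑ i, if u i then lam g i else 0) = rr g))
    (a : Fin L → Bool) (b : Fin R → Bool) (r s : ℕ) :
    ‖∑ v : Fin ℓ → Bool, GowersCube.signChar (classPar c y a b r v) * omega3 ^ wt v‖ ≤
      3 ^ (wideCuts lam s).card * (2 ^ ℓ * Real.exp (-(etaP p * ℓ / 4 ^ (s + 1)))) := by
  set Gr := univ.filter (fun g : Fin (L + ℓ + R + 1) => gapChar ℓ c a b g.val r % 3 ≠ 0) with hGr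
  set Wr := Gr.filter (fun g => s < (wsupp lam g).card) with hWr
  set Nr := Gr.filter (fun g => ¬ s < (wsupp lam g).card) with hNr
  set Qn : CubeFn (ZMod 2) ℓ := ∑ g ∈ Nr, fireFn y a b g with hQn_def
  have hQn : Qn ∈ lowDeg (ZMod 2) ℓ s := Submodule.sum_mem _ fun g hg =>
    lowDeg_mono (not_lt.1 (Finset.mem_filter.1 hg).2) (fireFn_mem_lowDeg_wsupp y lam rr hyl g a b)
  have hsplit : classPar c y a b r = (∑ g ∈ Wr, fireFn y a b g) + Qn := by
    rw [hQn_def, hWr, hNr, Finset.sum_filter_add_sum_filter_not, hGr]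
    rfl
  have hsgn : ∀ v, GowersCube.signChar (classPar c y a b r v) =
      GowersCube.signChar (Qn v) * ∏ g ∈ Wr, hypSgn (lamW lam g) (rhoW lam rr a b g) v := by
    intro v
    rw [hsplit, Pi.add_apply, GowersCube.signChar_add, Finset.sum_apply, signChar_finset_sum, mul_comm]
    congr 1
    exact Finset.prod_congr rfl fun g _ => signChar_fireFn y lam rr hyl a b g v
  have hT : ∀ μ : Fin ℓ → ZMod p,
      ‖∑ v, (GowersCube.signChar (Qn v) * omega3 ^ wt v) * ZMod.stdAddChar (linPart μ v)‖ ≤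
        2 ^ ℓ * Real.exp (-(etaP p * ℓ / 4 ^ (s + 1))) :=
    fun μ => norm_twisted_narrow_le hp3 hQn μ
  have h := norm_sum_mul_prod_hypSgn_le _ hT Wr (fun g => lamW lam g) (fun g => rhoW lam rr a b g) 0
  have h0 : ∀ v : Fin ℓ → Bool, (ZMod.stdAddChar (linPart (0 : Fin ℓ → ZMod p) v) : ℂ) = 1 := by
    intro v
    rw [show linPart (0 : Fin ℓ → ZMod p) v = 0 by simp [linPart], AddChar.map_zero_eq_one]
  simp_rw [h0, mul_one] at h
  have hW : Wr.card ≤ (wideCuts lam s).card := Finset.card_le_card fun g hg => by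
    simp only [hWr, wideCuts, Finset.mem_filter, Finset.mem_univ, true_and] at hg ⊢
    exact hg.2
  calc ‖∑ v, GowersCube.signChar (classPar c y a b r v) * omega3 ^ wt v‖
      = ‖∑ v, GowersCube.signChar (Qn v) * omega3 ^ wt v *
          ∏ g ∈ Wr, hypSgn (lamW lam g) (rhoW lam rr a b g) v‖ := by
        congr 1
        refine Finset.sum_congr rfl fun v _ => ?_
        rw [hsgn v]
        ring
    _ ≤ 3 ^ Wr.card * (2 ^ ℓ * Real.exp (-(etaP p * ℓ / 4 ^ (s + 1)))) := h
    _ ≤ 3 ^ (wideCuts lam s).card * (2 ^ ℓ * Real.exp (-(etaP p * ℓ / 4 ^ (s + 1)))) :=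
        mul_le_mul_of_nonneg_right (pow_le_pow_right₀ (by norm_num) hW) (by positivity)

/-- **Balance of the class-parity supports** (no degree hypothesis on the wide cuts): for `p ≠ 3`,
`3·#{v : classPar_r v ≠ 0, |v| ≡ r} ≤ #{classPar_r ≠ 0} + 1 + 3^{#wide}·2^ℓ·exp(−η_p ℓ/4^{s+1})`. -/
theorem three_mul_card_parClass_le (hp3 : p ≠ 3)
    (hyl : ∀ g u, y g u = decide ((∑ i, if u i then lam g i else 0) = rr g))
    (a : Fin L → Bool) (b : Fin R → Bool) (r s : ℕ) :
    (3 : ℝ) * (univ.filter fun v : Fin ℓ → Bool => classPar c y a b r v ≠ 0 ∧ wt v % 3 = r % 3).card ≤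
      (univ.filter fun v : Fin ℓ → Bool => classPar c y a b r v ≠ 0).card +
        (1 + 3 ^ (wideCuts lam s).card * (2 ^ ℓ * Real.exp (-(etaP p * ℓ / 4 ^ (s + 1))))) := by
  set B := univ.filter fun v : Fin ℓ → Bool => classPar c y a b r v ≠ 0 with hB
  have h1 := abs_three_mul_card_filter_mod_sub_card_le B r
  have hwt : ∀ v : Fin ℓ → Bool, Hegedus.wt v = wt v := fun v => rfl
  simp only [hwt] at h1
  have hBf : B.filter (fun v => wt v % 3 = r % 3) =
      univ.filter (fun v : Fin ℓ → Bool => classPar c y a b r v ≠ 0 ∧ wt v % 3 = r % 3) := by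
    rw [hB, Finset.filter_filter]
  have hid : 2 * ∑ v ∈ B, omega3 ^ wt v = (∑ v : Fin ℓ → Bool, omega3 ^ wt v) -
      ∑ v, GowersCube.signChar (classPar c y a b r v) * omega3 ^ wt v := by
    rw [hB, Finset.sum_filter, Finset.mul_sum, ← Finset.sum_sub_distrib]
    refine Finset.sum_congr rfl fun v _ => ?_
    by_cases hv : classPar c y a b r v = 0
    · simp [hv]
    · simp [hv, GowersCube.signChar]
      ring
  have hT1 : ‖∑ v : Fin ℓ → Bool, omega3 ^ wt v‖ = 1 := norm_sum_omega3_pow_wt ℓ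
  have hV := norm_classSum_le c y lam rr hp3 hyl a b r s
  have hnorm : 2 * ‖∑ v ∈ B, omega3 ^ wt v‖ ≤
      1 + 3 ^ (wideCuts lam s).card * (2 ^ ℓ * Real.exp (-(etaP p * ℓ / 4 ^ (s + 1)))) := by
    calc 2 * ‖∑ v ∈ B, omega3 ^ wt v‖ = ‖2 * ∑ v ∈ B, omega3 ^ wt v‖ := by
          rw [norm_mul, Complex.norm_ofNat]
      _ = ‖(∑ v : Fin ℓ → Bool, omega3 ^ wt v) -
            ∑ v, GowersCube.signChar (classPar c y a b r v) * omega3 ^ wt v‖ := by rw [hid]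
      _ ≤ ‖∑ v : Fin ℓ → Bool, omega3 ^ wt v‖ +
            ‖∑ v, GowersCube.signChar (classPar c y a b r v) * omega3 ^ wt v‖ := norm_sub_le _ _
      _ ≤ 1 + 3 ^ (wideCuts lam s).card * (2 ^ ℓ * Real.exp (-(etaP p * ℓ / 4 ^ (s + 1)))) := by
          rw [hT1]; linarith
  have h2 := (abs_le.1 h1).2
  rw [hBf] at h2
  linarith

/-- **MIXED FIBRE THEOREM**: on a cut-free window of a linear-test strategy (`p ≠ 3`), for every width `s`,
`3·#WIN ≤ 2·2^ℓ + 3·(1 + 3^{#wide(s)}·2^ℓ·e^{−η_p ℓ/4^{s+1}})` on every outside fibre.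
[cut structure used: only two-liveness `sum_three_classes_le` [g24]] -/
theorem three_mul_win_fibre_le_mixed (hp3 : p ≠ 3)
    (hyl : ∀ g u, y g u = decide ((∑ i, if u i then lam g i else 0) = rr g)) (hgap : CutFree y L ℓ)
    (s : ℕ) (a : Fin L → Bool) (b : Fin R → Bool) :
    (3 : ℝ) * (univ.filter fun v : Fin ℓ → Bool => ringWinU c y (glue3 a v b) = true).card ≤
      2 * 2 ^ ℓ + 3 * (1 + 3 ^ (wideCuts lam s).card * (2 ^ ℓ * Real.exp (-(etaP p * ℓ / 4 ^ (s + 1))))) := by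
  set E := (1 + 3 ^ (wideCuts lam s).card * (2 ^ ℓ * Real.exp (-(etaP p * ℓ / 4 ^ (s + 1))))) with hE
  rw [card_win_fibre_eq c y hgap a b]
  push_cast
  rw [Finset.mul_sum]
  have hclass : ∀ r ∈ range 3,
      (3 : ℝ) * ((univ.filter fun v : Fin ℓ → Bool => wt v % 3 = r ∧ fireCount c y a b r v % 2 = 1).card : ℝ) ≤
        ((univ.filter fun v : Fin ℓ → Bool => fireCount c y a b r v % 2 = 1).card : ℝ) + E := by
    intro r hr
    have hr3 : r % 3 = r := Nat.mod_eq_of_lt (Finset.mem_range.1 hr)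
    have h := three_mul_card_parClass_le c y lam rr hp3 hyl a b r s
    have e1 : (univ.filter fun v : Fin ℓ → Bool => classPar c y a b r v ≠ 0 ∧ wt v % 3 = r % 3) =
        univ.filter fun v : Fin ℓ → Bool => wt v % 3 = r ∧ fireCount c y a b r v % 2 = 1 := by
      refine Finset.filter_congr fun v _ => ?_
      rw [classPar_ne_zero_iff, hr3]
      exact and_comm
    have e2 : (univ.filter fun v : Fin ℓ → Bool => classPar c y a b r v ≠ 0) =
        univ.filter fun v : Fin ℓ → Bool => fireCount c y a b r v % 2 = 1 :=
      Finset.filter_congr fun v _ => classPar_ne_zero_iff c y a b r v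
    rw [e1, e2] at h
    exact h
  have hsum : (∑ r ∈ range 3, ((univ.filter fun v : Fin ℓ → Bool => fireCount c y a b r v % 2 = 1).card : ℝ)) ≤
      2 * 2 ^ ℓ := by
    have h := sum_three_classes_le c y a b
    have h' : ((∑ r ∈ range 3, (univ.filter fun v : Fin ℓ → Bool => fireCount c y a b r v % 2 = 1).card : ℕ) : ℝ)
        ≤ ((2 * 2 ^ ℓ : ℕ) : ℝ) := by exact_mod_cast h
    push_cast at h'
    exact h'
  calc ∑ r ∈ range 3, (3 : ℝ) * ((univ.filter fun v : Fin ℓ → Bool =>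
          wt v % 3 = r ∧ fireCount c y a b r v % 2 = 1).card : ℝ)
      ≤ ∑ r ∈ range 3, (((univ.filter fun v : Fin ℓ → Bool => fireCount c y a b r v % 2 = 1).card : ℝ) + E) :=
        Finset.sum_le_sum hclass
    _ = (∑ r ∈ range 3, ((univ.filter fun v : Fin ℓ → Bool => fireCount c y a b r v % 2 = 1).card : ℝ)) + 3 * E := by
        rw [Finset.sum_add_distrib, Finset.sum_const, Finset.card_range]
        simp
    _ ≤ 2 * 2 ^ ℓ + 3 * E := by linarith

/-- **Absorption of the mixed error**: with `2·4^{s+1} ≤ M·η` and `(k+2)·M ≤ ℓ` (`0 < η ≤ 2`):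
`4·(1 + 3^k·2^ℓ·e^{−ηℓ/4^{s+1}}) ≤ 2^ℓ` (because then `ηℓ/4^{s+1} ≥ 2k+4`, `3 ≤ e²`, `ℓ ≥ 8`). -/
theorem mixed_err_absorb {η : ℝ} (hη0 : 0 < η) (hη2 : η ≤ 2) {s M k ℓ : ℕ}
    (hM : 2 * 4 ^ (s + 1) ≤ (M : ℝ) * η) (hℓ : (k + 2) * M ≤ ℓ) :
    4 * (1 + 3 ^ k * (2 ^ ℓ * Real.exp (-(η * ℓ / 4 ^ (s + 1))))) ≤ (2 : ℝ) ^ ℓ := by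
  have h4pos : (0 : ℝ) < 4 ^ (s + 1) := by positivity
  have h4ge : (4 : ℝ) ≤ 4 ^ (s + 1) := by
    calc (4 : ℝ) = 4 ^ 1 := by norm_num
      _ ≤ 4 ^ (s + 1) := pow_le_pow_right₀ (by norm_num) (by omega)
  have hℓr : ((k : ℝ) + 2) * M ≤ ℓ := by exact_mod_cast hℓ
  have hMnn : (0 : ℝ) ≤ M := Nat.cast_nonneg M
  have hknn : (0 : ℝ) ≤ k := Nat.cast_nonneg k
  -- the exponent is at least 2k + 4
  have hexp_arg : 2 * ((k : ℝ) + 2) ≤ η * ℓ / 4 ^ (s + 1) := by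
    rw [le_div_iff₀ h4pos]
    have h1 : ((k : ℝ) + 2) * (2 * 4 ^ (s + 1)) ≤ ((k : ℝ) + 2) * (M * η) :=
      mul_le_mul_of_nonneg_left hM (by positivity)
    have h2 : ((k : ℝ) + 2) * (M * η) ≤ η * ℓ := by nlinarith [hℓr, hη0.le]
    linarith
  have hexp : Real.exp (-(η * ℓ / 4 ^ (s + 1))) ≤ Real.exp (-2) ^ (k + 2) := by
    rw [← Real.exp_nat_mul]
    apply Real.exp_le_exp.2
    push_cast
    linarith
  -- 3·e^{-2} ≤ 1 and e^{-2}² ≤ 1/9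
  have he2 : 3 * Real.exp (-2) ≤ 1 := by
    have h := Real.add_one_le_exp (2 : ℝ)
    have hinv : Real.exp (-2) * Real.exp 2 = 1 := by rw [← Real.exp_add]; norm_num
    nlinarith [Real.exp_pos (-2), Real.exp_pos 2]
  have h3k : (3 : ℝ) ^ k * Real.exp (-2) ^ (k + 2) ≤ 1 / 9 := by
    rw [pow_add, ← mul_assoc, ← mul_pow]
    have h1 : (3 * Real.exp (-2)) ^ k ≤ 1 := pow_le_one₀ (by positivity) he2
    have h2 : Real.exp (-2) ^ 2 ≤ 1 / 9 := by nlinarith [he2, Real.exp_pos (-2)]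
    calc (3 * Real.exp (-2)) ^ k * Real.exp (-2) ^ 2 ≤ 1 * (1 / 9) :=
          mul_le_mul h1 h2 (by positivity) (by norm_num)
      _ = 1 / 9 := by ring
  -- ℓ ≥ 8
  have hM4 : (4 : ℝ) ≤ M := by nlinarith [hM, hη2, h4ge, hMnn]
  have hℓ8 : (8 : ℝ) ≤ ℓ := by nlinarith [hℓr, hM4, hknn]
  have hℓ8' : 8 ≤ ℓ := by exact_mod_cast hℓ8
  have h256 : (256 : ℝ) ≤ 2 ^ ℓ := by
    calc (256 : ℝ) = 2 ^ 8 := by norm_num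
      _ ≤ 2 ^ ℓ := pow_le_pow_right₀ (by norm_num) hℓ8'
  have hmain : 3 ^ k * (2 ^ ℓ * Real.exp (-(η * ℓ / 4 ^ (s + 1)))) ≤ (2 : ℝ) ^ ℓ / 9 := by
    have h1 : (3 : ℝ) ^ k * 2 ^ ℓ * Real.exp (-(η * ℓ / 4 ^ (s + 1))) ≤
        3 ^ k * 2 ^ ℓ * Real.exp (-2) ^ (k + 2) := mul_le_mul_of_nonneg_left hexp (by positivity)
    calc (3 : ℝ) ^ k * (2 ^ ℓ * Real.exp (-(η * ℓ / 4 ^ (s + 1))))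
        = 3 ^ k * 2 ^ ℓ * Real.exp (-(η * ℓ / 4 ^ (s + 1))) := by ring
      _ ≤ 3 ^ k * 2 ^ ℓ * Real.exp (-2) ^ (k + 2) := h1
      _ = 2 ^ ℓ * (3 ^ k * Real.exp (-2) ^ (k + 2)) := by ring
      _ ≤ 2 ^ ℓ * (1 / 9) := mul_le_mul_of_nonneg_left h3k (by positivity)
      _ = 2 ^ ℓ / 9 := by ring
  linarith

/-- **MIXED FIBRE THEOREM, absorbed**: `2·4^{s+1} ≤ M·η_p` and `(#wide(s) + 2)·M ≤ ℓ` ⟹ `12·#WIN ≤ 11·2^ℓ`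
on every outside fibre. -/
theorem twelve_mul_win_fibre_le_mixed (hp3 : p ≠ 3)
    (hyl : ∀ g u, y g u = decide ((∑ i, if u i then lam g i else 0) = rr g)) (hgap : CutFree y L ℓ)
    {s M : ℕ} (hM : 2 * 4 ^ (s + 1) ≤ (M : ℝ) * etaP p) (hℓ : ((wideCuts lam s).card + 2) * M ≤ ℓ)
    (a : Fin L → Bool) (b : Fin R → Bool) :
    12 * (univ.filter fun v : Fin ℓ → Bool => ringWinU c y (glue3 a v b) = true).card ≤ 11 * 2 ^ ℓ := by
  have h3 := three_mul_win_fibre_le_mixed c y lam rr hp3 hyl hgap s a b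
  have hE := mixed_err_absorb (etaP_pos (p := p)) (etaP_le_two p) hM hℓ
  have h : (12 : ℝ) * ((univ.filter fun v : Fin ℓ → Bool => ringWinU c y (glue3 a v b) = true).card : ℝ) ≤
      11 * (2 : ℝ) ^ ℓ := by linarith
  exact_mod_cast h

end MixedFibre

/-- **MIXED WINDOW THEOREM** (Fubini over the outside fibres): `12·#WIN ≤ 11·2ⁿ`. -/
theorem window_bound_mixed {p : ℕ} [Fact p.Prime] (hp3 : p ≠ 3) (L ℓ R : ℕ) (c : ℕ)
    (y : Fin (L + ℓ + R + 1) → (Fin (L + ℓ + R) → Bool) → Bool)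
    (lam : Fin (L + ℓ + R + 1) → Fin (L + ℓ + R) → ZMod p) (rr : Fin (L + ℓ + R + 1) → ZMod p)
    (hyl : ∀ g u, y g u = decide ((∑ i, if u i then lam g i else 0) = rr g)) (hgap : CutFree y L ℓ)
    {s M : ℕ} (hM : 2 * 4 ^ (s + 1) ≤ (M : ℝ) * etaP p) (hℓ : ((wideCuts lam s).card + 2) * M ≤ ℓ) :
    12 * (univ.filter fun u : Fin (L + ℓ + R) → Bool => ringWinU c y u = true).card ≤ 11 * 2 ^ (L + ℓ + R) := by
  rw [card_filter_eq_sum_glue3 (fun w => ringWinU c y w = true), Finset.mul_sum]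
  calc ∑ a : Fin L → Bool, 12 * ∑ b : Fin R → Bool,
        (univ.filter fun v : Fin ℓ → Bool => ringWinU c y (glue3 a v b) = true).card
      ≤ ∑ _a : Fin L → Bool, 2 ^ R * (11 * 2 ^ ℓ) := by
        refine Finset.sum_le_sum fun a _ => ?_
        rw [Finset.mul_sum]
        calc ∑ b : Fin R → Bool, 12 * (univ.filter fun v : Fin ℓ → Bool => ringWinU c y (glue3 a v b) = true).card
            ≤ ∑ _b : Fin R → Bool, 11 * 2 ^ ℓ :=
              Finset.sum_le_sum fun b _ => twelve_mul_win_fibre_le_mixed c y lam rr hp3 hyl hgap hM hℓ a b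
          _ = 2 ^ R * (11 * 2 ^ ℓ) := by
            rw [Finset.sum_const, Finset.card_univ, Fintype.card_fun, Fintype.card_bool, Fintype.card_fin,
              smul_eq_mul]
    _ = 2 ^ L * (2 ^ R * (11 * 2 ^ ℓ)) := by
        rw [Finset.sum_const, Finset.card_univ, Fintype.card_fun, Fintype.card_bool, Fintype.card_fin,
          smul_eq_mul]
    _ = 11 * 2 ^ (L + ℓ + R) := by rw [pow_add, pow_add]; ring

end Summit.QuantumAdvantage.QuantumAdvantage.Theorems.RankDial

end
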